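import Literature.Probability.Percolation.DecisionTreeTwoConfig
import Mathlib.Tactic.FinCases
import HarnessLib

/-!
# Three-configuration decision trees with per-edge permutations: the switching lemma for three
# independent copies (Gladkov–Zimin 2024, Lemma 4.2; Gladkov 2024, Lemma 3.1 — three-copy form)

Topic `Literature/Probability/Percolation`. Sources: N. Gladkov, A. Zimin, *Bond percolation does not
simulate site percolation*, Electron. Commun. Probab. (2026), arXiv:2404.08873 [GladkovZimin2024], Lemma 4.2
(p. 6): "Consider two independent Bernoulli bond percolations `C₁` and `C₂` having the same distribution `μ`
on the same graph `G`. Let a decision tree `T` select each edge and reveal it in both `C₁` and `C₂`.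
Furthermore, allow on each step, before revealing, to decide if this edge will go to the set `S` … or to its
complement `S̄`. Then `C₁ →_S C₂` is independent of `C₂ →_S C₁ = C₁ →_S̄ C₂` and both of them are distributed
as `μ`."  Proof (ibid.): "for every pair of configurations `C₃, C₄` there is only one path in any decision tree
leading to [them] and the probability of this path is equal to `ℙ(C₁)ℙ(C₂)`, which is equal to `ℙ(C₃)ℙ(C₄)`
since the probability in Bernoulli percolation is a product of probabilities for individual edges."
The same statement and proof for `k` independent copies, where at each queried edge the tree chooses —
before revealing the `k` bits — a PERMUTATION of the copies to apply at that edge, is the form used by every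
three-copy switching argument (an `S`/`S̄` decision is the case `k = 2`, transposition/identity); it is
recorded here for `k = 3` [folklore extension of GladkovZimin2024 Lemma 4.2 / Gladkov2024 Lemma 3.1].
`DecisionTreeTwoConfig.lean` is the two-configuration file this one extends; all notation (`wtW`, `PrW`,
`ins`, `wt1`, `wtW_ins`) is reused from it and from `DecisionTreeWeighted.lean`.  All PROVED, no facts.

* `wt3W D p x = ∏ i, wtW D p (x i)` and `Pr3W` — weight / probability of a triple `x : Fin 3 → Finset ι`
  of independent configurations (coordinate `e` open in copy `i` iff `e ∈ x i`), each copy with the SAME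
  edge probabilities `p`;
* `DTree3 ι` — a leaf carrying the permutation applied to all unqueried edges, or a node querying an edge
  `e` with a permutation `π` (output `i` receives copy `π i` at `e`) and eight children indexed by the
  revealed bits `Fin 3 → Bool`;  `support3`, `Valid3` (no descendant re-queries an ancestor's edge),
  `swap3 T x` — the output triple;
* `sum_triples_split` — splitting the weighted sum over triples along one coordinate;
* **`sum_wt3W_comp_swap3`** — for a valid tree querying edges of `D` and every `f`,
  `Σ_x wt3W x · f (swap3 T x) = Σ_x wt3W x · f x` (the output triple has the law of the input triple);
  `Pr3W_preimage_swap3` (pushforward form), `Pr3W_pi` (product events) and `Pr3W_swap3_mem_pi`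
  ("the three outputs are independent, each with law `μ`");
* `certificate_sum_nonpos` — the certificate principle of [GladkovZimin2024, §5] for three copies: potentials
  on codes of the input triple and of the outputs of finitely many valid trees that sum to `≤ 0` POINTWISE
  have total `μ^{⊗3}`-expectation `≤ 0`.

Proof: induction on the tree, exactly as in the two-copy case: at a node querying `e ∈ D` split the triple
space along `e`; on the block with revealed bits `b` the output is the child's output on `D.erase e` with the
bits `b ∘ π` put back (`swap3_node_ins`); the child does not query `e` (`Valid3`), the induction hypothesis
removes the child's switching, and re-indexing the bits `b ↦ b ∘ π` (a bijection of `Fin 3 → Bool`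
preserving `∏ i, wt1 (b i)`) finishes; at a leaf the outputs are a fixed permutation of the inputs.

Application (crux `NoHeavyLowerTail` of `Summits/CriticalPhenomena/PercolationContinuityZ3`, three-copy
switching certificates for cubic connection-probability inequalities): every "sealed exploration program"
(explore a terminal's cluster in one copy, give its incident edges a permutation, repeat, final permutation)
is such a tree, so each program preserves `μ ⊗ μ ⊗ μ`.

## References
* [GladkovZimin2024] N. Gladkov, A. Zimin, arXiv:2404.08873, Def. 4.1, Lemma 4.2, Examples 4.3–4.4.
* [Gladkov2024] N. Gladkov, *Percolation Inequalities and Decision Trees*, arXiv:2408.08457v2, Def. 2.4,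
  Lemma 3.1.
-/

noncomputable section

open Classical

namespace Literature.Probability.Percolation

namespace DecisionTree

open Finset

variable {ι : Type*} [DecidableEq ι]

/-! ### Triples of configurations and their weights -/

/-- The weight of a triple of independent configurations with common edge probabilities `p`:
`∏_{i < 3} wtW D p (x i)`. [cite: GladkovZimin2024, Lemma 4.2 (independent copies with the same law)] -/
def wt3W (D : Finset ι) (p : ι → ℝ) (x : Fin 3 → Finset ι) : ℝ := ∏ i, wtW D p (x i)

/-- The finite set of triples of configurations inside `D`. [folklore] -/
def triples (D : Finset ι) : Finset (Fin 3 → Finset ι) := Fintype.piFinset fun _ : Fin 3 => D.powerset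

/-- The probability of an event of a triple of independent configurations:
`Σ_{x ∈ triples D} wt3W x · 1[x ∈ Y]`. [cite: GladkovZimin2024, Lemma 4.2] -/
def Pr3W (D : Finset ι) (p : ι → ℝ) (Y : Set (Fin 3 → Finset ι)) : ℝ :=
  ∑ x ∈ triples D, Y.indicator (wt3W D p) x

omit [DecidableEq ι] in
/-- Membership in `triples D`: every copy is a configuration inside `D`. [folklore] -/
theorem mem_triples {D : Finset ι} {x : Fin 3 → Finset ι} : x ∈ triples D ↔ ∀ i, x i ⊆ D := by
  simp [triples, Fintype.mem_piFinset]

/-- `Pr3W` as a weighted sum of the indicator. [folklore] -/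
theorem Pr3W_eq_sum_ind (D : Finset ι) (p : ι → ℝ) (Y : Set (Fin 3 → Finset ι)) :
    Pr3W D p Y = ∑ x ∈ triples D, wt3W D p x * ind Y x := by
  unfold Pr3W
  refine sum_congr rfl fun x _ => ?_
  by_cases hx : x ∈ Y
  · rw [Set.indicator_of_mem hx, ind_of_mem hx, mul_one]
  · rw [Set.indicator_of_notMem hx, ind_of_not_mem hx, mul_zero]

/-! ### Three-configuration trees with permutations -/

/-- A decision tree over three configurations: a leaf carrying the permutation applied at every edge not
queried on the path to it, or a node querying the edge `e`, applying the permutation `π` at `e` (output `i`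
receives the bit of copy `π i`), with eight children indexed by the three revealed bits.
[cite: GladkovZimin2024, Lemma 4.2 (decision tree choosing, before revealing, where the edge goes);
three-copy/permutation form] -/
inductive DTree3 (ι : Type*) : Type _
  | leaf (π : Equiv.Perm (Fin 3)) : DTree3 ι
  | node (e : ι) (π : Equiv.Perm (Fin 3)) (ch : (Fin 3 → Bool) → DTree3 ι) : DTree3 ι

namespace DTree3

open DTree2

/-- All edges queried anywhere in the tree. [cite: Gladkov2024, Def. 2.4] -/
def support3 : DTree3 ι → Finset ι
  | leaf _ => ∅
  | node e _ ch => insert e (Finset.univ.biUnion fun b => support3 (ch b))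

/-- Well-formedness: no descendant of a node re-queries the node's edge ("the nodes on every path from the
root query pairwise distinct edges"). [cite: Gladkov2024, Def. 2.4] -/
def Valid3 : DTree3 ι → Prop
  | leaf _ => True
  | node e _ ch => (∀ b, e ∉ support3 (ch b)) ∧ ∀ b, Valid3 (ch b)

/-- The output triple of the tree on the input triple `x`: at a node querying `e` with permutation `π`,
output `i` gets the `e`-bit of copy `π i`, and the remaining coordinates are processed by the child selected
by the revealed bits; at a leaf the remaining coordinates of output `i` are those of copy `π i`.
[cite: GladkovZimin2024, Def. 4.1 and Lemma 4.2 (`C₁ →_S C₂`, `C₂ →_S C₁`); three-copy form] -/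
def swap3 : DTree3 ι → (Fin 3 → Finset ι) → (Fin 3 → Finset ι)
  | leaf π, x => fun i => x (π i)
  | node e π ch, x => fun i =>
      ins e (decide (e ∈ x (π i))) (swap3 (ch fun j => decide (e ∈ x j)) (fun j => (x j).erase e) i)

/-! ### Basic facts -/

/-- The support of a child lies in the support of the node. [folklore] -/
theorem support3_child_subset (e : ι) (π : Equiv.Perm (Fin 3)) (ch : (Fin 3 → Bool) → DTree3 ι)
    (b : Fin 3 → Bool) : support3 (ch b) ⊆ support3 (node e π ch) := by
  intro i hi
  simp only [support3, mem_insert, mem_biUnion, mem_univ, true_and]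
  exact Or.inr ⟨b, hi⟩

/-- A valid node's children are valid and do not query the node's edge. [folklore] -/
theorem valid3_child {e : ι} {π : Equiv.Perm (Fin 3)} {ch : (Fin 3 → Bool) → DTree3 ι}
    (h : Valid3 (node e π ch)) (b : Fin 3 → Bool) : Valid3 (ch b) ∧ e ∉ support3 (ch b) :=
  ⟨h.2 b, h.1 b⟩

/-- The bit read back from `ins e b R` at `e` is `b` (for `e ∉ R`). [folklore] -/
theorem decide_mem_ins {e : ι} (b : Bool) {R : Finset ι} (he : e ∉ R) : decide (e ∈ ins e b R) = b := by
  cases b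
  · exact decide_eq_false ((mem_ins_self_iff he).not.2 (by simp))
  · exact decide_eq_true ((mem_ins_self_iff he).2 rfl)

/-- Erasing `e` from `ins e b R` gives back `R` (for `e ∉ R`). [folklore] -/
theorem erase_ins {e : ι} (b : Bool) {R : Finset ι} (he : e ∉ R) : (ins e b R).erase e = R := by
  ext i
  by_cases hie : i = e
  · subst hie; simp [he]
  · simp [mem_erase, hie, mem_ins_of_ne hie]

/-- `ins e (decide (e ∈ C)) (C.erase e) = C`. [folklore] -/
theorem ins_decide_erase (e : ι) (C : Finset ι) : ins e (decide (e ∈ C)) (C.erase e) = C := by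
  ext j
  by_cases hje : j = e
  · subst hje
    by_cases hjx : j ∈ C
    · simp [mem_ins, hjx]
    · simp [mem_ins, hjx]
  · simp [mem_ins, hje, mem_erase]

/-- The output at a node on inputs split at `e`: with bits `b` revealed, output `i` is the child's output on
the `e`-erased inputs with the bit `b (π i)` put back. [cite: GladkovZimin2024, proof of Lemma 4.2] -/
theorem swap3_node_ins {e : ι} {π : Equiv.Perm (Fin 3)} {ch : (Fin 3 → Bool) → DTree3 ι}
    (b : Fin 3 → Bool) {y : Fin 3 → Finset ι} (hy : ∀ i, e ∉ y i) :
    swap3 (node e π ch) (fun i => ins e (b i) (y i)) = fun i => ins e (b (π i)) (swap3 (ch b) y i) := by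
  have hb : (fun j => decide (e ∈ ins e (b j) (y j))) = b := funext fun j => decide_mem_ins (b j) (hy j)
  have hy' : (fun j => (ins e (b j) (y j)).erase e) = y := funext fun j => erase_ins (b j) (hy j)
  funext i
  simp only [swap3]
  rw [hb, hy', decide_mem_ins (b (π i)) (hy (π i))]

/-! ### Splitting the triple space along one coordinate -/
section Split

variable (D : Finset ι) (p : ι → ℝ)

/-- Weight factorisation of a triple split at `e ∈ D`. [folklore] -/
theorem wt3W_ins {e : ι} (he : e ∈ D) (b : Fin 3 → Bool) {y : Fin 3 → Finset ι}
    (hy : ∀ i, y i ⊆ D.erase e) :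
    wt3W D p (fun i => ins e (b i) (y i)) = (∏ i, wt1 p e (b i)) * wt3W (D.erase e) p y := by
  unfold wt3W
  rw [← prod_mul_distrib]
  exact prod_congr rfl fun i _ => wtW_ins D p he (b i) (hy i)

/-- Splitting a weighted sum over triples along `e ∈ D`: a triple inside `D` is a choice of three bits at `e`
and a triple inside `D.erase e`, and the weight factorises. [folklore] -/
theorem sum_triples_split {e : ι} (he : e ∈ D) (F : (Fin 3 → Finset ι) → ℝ) :
    ∑ x ∈ triples D, wt3W D p x * F x =
      ∑ b : Fin 3 → Bool, (∏ i, wt1 p e (b i)) *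
        ∑ y ∈ triples (D.erase e), wt3W (D.erase e) p y * F (fun i => ins e (b i) (y i)) := by
  classical
  -- write the right-hand side as one sum over pairs `(b, y)`
  have hR : ∑ b : Fin 3 → Bool, (∏ i, wt1 p e (b i)) *
        ∑ y ∈ triples (D.erase e), wt3W (D.erase e) p y * F (fun i => ins e (b i) (y i)) =
      ∑ q ∈ (Finset.univ : Finset (Fin 3 → Bool)) ×ˢ triples (D.erase e),
        (∏ i, wt1 p e (q.1 i)) * (wt3W (D.erase e) p q.2 * F (fun i => ins e (q.1 i) (q.2 i))) := by
    rw [sum_product]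
    refine sum_congr rfl fun b _ => ?_
    rw [mul_sum]
  rw [hR]
  symm
  refine sum_nbij' (fun q => fun i => ins e (q.1 i) (q.2 i))
    (fun x => (fun i => decide (e ∈ x i), fun i => (x i).erase e)) ?_ ?_ ?_ ?_ ?_
  · intro q hq
    rw [mem_product] at hq
    have hy := mem_triples.1 hq.2
    refine mem_triples.2 fun i => ?_
    intro j hj
    rcases mem_ins.1 hj with ⟨rfl, -⟩ | hj
    · exact he
    · exact mem_of_mem_erase (hy i hj)
  · intro x hx
    rw [mem_product]
    refine ⟨mem_univ _, mem_triples.2 fun i => ?_⟩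
    exact erase_subset_erase e (mem_triples.1 hx i)
  · intro q hq
    rw [mem_product] at hq
    have hy := mem_triples.1 hq.2
    have hey : ∀ i, e ∉ q.2 i := fun i h => (mem_erase.1 (hy i h)).1 rfl
    refine Prod.ext ?_ ?_
    · funext i; exact decide_mem_ins (q.1 i) (hey i)
    · funext i; exact erase_ins (q.1 i) (hey i)
  · intro x _
    funext i
    exact ins_decide_erase e (x i)
  · intro q hq
    rw [mem_product] at hq
    have hy := mem_triples.1 hq.2
    rw [wt3W_ins D p he q.1 hy]
    ring

end Split

/-! ### The switching lemma: the output triple has the law of the input triple -/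
section Swap

variable (p : ι → ℝ)

omit [DecidableEq ι] in
/-- Re-indexing the triple space by a permutation of the copies. [folklore] -/
theorem sum_triples_comp_perm (D : Finset ι) (π : Equiv.Perm (Fin 3)) (G : (Fin 3 → Finset ι) → ℝ) :
    ∑ x ∈ triples D, G (fun i => x (π i)) = ∑ x ∈ triples D, G x := by
  refine sum_nbij' (fun x => fun i => x (π i)) (fun x => fun i => x (π.symm i)) ?_ ?_ ?_ ?_ ?_
  · intro x hx; exact mem_triples.2 fun i => mem_triples.1 hx (π i)
  · intro x hx; exact mem_triples.2 fun i => mem_triples.1 hx (π.symm i)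
  · intro x _; funext i; simp
  · intro x _; funext i; simp
  · intro x _; rfl

/-- The weight of a triple is invariant under permuting the copies. [folklore] -/
theorem wt3W_comp_perm (D : Finset ι) (π : Equiv.Perm (Fin 3)) (x : Fin 3 → Finset ι) :
    wt3W D p (fun i => x (π i)) = wt3W D p x := by
  unfold wt3W
  exact Equiv.prod_comp π (fun i => wtW D p (x i))

/-- **Switching lemma, three copies with per-edge permutations (finitary pushforward form).**  For a valid
three-configuration tree `T` querying edges of `D` and every function `f` of a triple of configurations,
`Σ_{x ∈ triples D} wt3W x · f (swap3 T x) = Σ_x wt3W x · f x`: the output triple has the law `μ ⊗ μ ⊗ μ` of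
the input triple. [cite: GladkovZimin2024, Lemma 4.2; Gladkov2024, Lemma 3.1 — three-copy form, same proof] -/
theorem sum_wt3W_comp_swap3 (T : DTree3 ι) (hV : Valid3 T) (D : Finset ι) (hD : support3 T ⊆ D)
    (f : (Fin 3 → Finset ι) → ℝ) :
    ∑ x ∈ triples D, wt3W D p x * f (swap3 T x) = ∑ x ∈ triples D, wt3W D p x * f x := by
  induction T generalizing D f with
  | leaf π =>
      simp only [swap3]
      have h : ∑ x ∈ triples D, wt3W D p (fun i => x (π i)) * f (fun i => x (π i)) =
          ∑ x ∈ triples D, wt3W D p x * f x :=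
        sum_triples_comp_perm D π (fun x => wt3W D p x * f x)
      rw [← h]
      exact sum_congr rfl fun x _ => by rw [wt3W_comp_perm]
  | node e π ch ih =>
      have he : e ∈ D := hD (by simp [support3])
      rw [sum_triples_split D p he, sum_triples_split D p he]
      have hblock : ∀ b : Fin 3 → Bool,
          ∑ y ∈ triples (D.erase e), wt3W (D.erase e) p y *
              f (swap3 (node e π ch) (fun i => ins e (b i) (y i))) =
            ∑ y ∈ triples (D.erase e), wt3W (D.erase e) p y *
              f (fun i => ins e (b (π i)) (y i)) := by
        intro b
        obtain ⟨hvc, hec⟩ := valid3_child hV b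
        have hDc : support3 (ch b) ⊆ D.erase e := by
          intro i hi
          exact mem_erase.2 ⟨fun h => hec (h ▸ hi), hD (support3_child_subset e π ch b hi)⟩
        rw [← ih b hvc (D.erase e) hDc (fun z => f (fun i => ins e (b (π i)) (z i)))]
        refine sum_congr rfl fun y hy => ?_
        have hey : ∀ i, e ∉ y i := fun i h => (mem_erase.1 (mem_triples.1 hy i h)).1 rfl
        rw [swap3_node_ins b hey]
      simp only [hblock]
      -- re-index the bits by `b ↦ b ∘ π`
      have hre : ∑ b : Fin 3 → Bool, (∏ i, wt1 p e (b i)) *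
            ∑ y ∈ triples (D.erase e), wt3W (D.erase e) p y * f (fun i => ins e (b (π i)) (y i)) =
          ∑ b : Fin 3 → Bool, (fun c : Fin 3 → Bool => (∏ i, wt1 p e (c i)) *
            ∑ y ∈ triples (D.erase e), wt3W (D.erase e) p y * f (fun i => ins e (c i) (y i)))
              (fun i => b (π i)) := by
        refine Fintype.sum_congr _ _ fun b => ?_
        simp only
        congr 1
        exact (Equiv.prod_comp π (fun i => wt1 p e (b i))).symm
      rw [hre]
      exact Equiv.sum_comp (π.arrowCongr (Equiv.refl Bool)).symm
        (fun c : Fin 3 → Bool => (∏ i, wt1 p e (c i)) *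
          ∑ y ∈ triples (D.erase e), wt3W (D.erase e) p y * f (fun i => ins e (c i) (y i)))

/-- `Pr3W` is invariant under the switching of a valid tree (pushforward form).
[cite: GladkovZimin2024, Lemma 4.2] -/
theorem Pr3W_preimage_swap3 {T : DTree3 ι} (hV : Valid3 T) {D : Finset ι} (hD : support3 T ⊆ D)
    (Y : Set (Fin 3 → Finset ι)) :
    Pr3W D p {x | swap3 T x ∈ Y} = Pr3W D p Y := by
  rw [Pr3W_eq_sum_ind, Pr3W_eq_sum_ind]
  have h := sum_wt3W_comp_swap3 p T hV D hD (ind Y)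
  refine Eq.trans (sum_congr rfl fun x _ => ?_) h
  by_cases hx : swap3 T x ∈ Y
  · rw [ind_of_mem hx, ind_of_mem (show x ∈ {x | swap3 T x ∈ Y} from hx)]
  · rw [ind_of_not_mem hx, ind_of_not_mem (show x ∉ {x | swap3 T x ∈ Y} from hx)]

/-- Product events of the triple space factorise: `Pr3W {x | ∀ i, x i ∈ X i} = ∏ i, PrW (X i)`.
[folklore] -/
theorem Pr3W_pi (D : Finset ι) (X : Fin 3 → Set (Finset ι)) :
    Pr3W D p {x | ∀ i, x i ∈ X i} = ∏ i, PrW D p (X i) := by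
  unfold Pr3W PrW triples
  rw [Finset.prod_univ_sum]
  refine sum_congr rfl fun x _ => ?_
  by_cases hx : ∀ i, x i ∈ X i
  · rw [Set.indicator_of_mem (show x ∈ {x : Fin 3 → Finset ι | ∀ i, x i ∈ X i} from hx)]
    unfold wt3W
    exact prod_congr rfl fun i _ => (Set.indicator_of_mem (hx i) _).symm
  · rw [Set.indicator_of_notMem (show x ∉ {x : Fin 3 → Finset ι | ∀ i, x i ∈ X i} from hx)]
    push Not at hx
    obtain ⟨i, hi⟩ := hx
    symm
    exact prod_eq_zero (mem_univ i) (Set.indicator_of_notMem hi _)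

/-- **Lemma 4.2 as printed, three copies**: the three outputs of a valid tree are independent and each has
law `μ`: `P^{⊗3}{∀ i, (swap3 T x) i ∈ X i} = ∏ i, P(X i)`. [cite: GladkovZimin2024, Lemma 4.2] -/
theorem Pr3W_swap3_mem_pi {T : DTree3 ι} (hV : Valid3 T) {D : Finset ι} (hD : support3 T ⊆ D)
    (X : Fin 3 → Set (Finset ι)) :
    Pr3W D p {x | ∀ i, swap3 T x i ∈ X i} = ∏ i, PrW D p (X i) := by
  rw [← Pr3W_pi]
  exact Pr3W_preimage_swap3 p hV hD {x | ∀ i, x i ∈ X i}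

/-! ### The certificate principle (Gladkov–Zimin §5): pointwise potentials summing to a nonpositive
function along a family of valid trees have nonpositive total expectation -/

/-- Triple weights are nonnegative for `p ∈ [0, 1]`. [folklore] -/
theorem wt3W_nonneg (D : Finset ι) {p : ι → ℝ} (hp0 : ∀ i, 0 ≤ p i) (hp1 : ∀ i, p i ≤ 1)
    (x : Fin 3 → Finset ι) : 0 ≤ wt3W D p x := by
  unfold wt3W
  exact prod_nonneg fun i _ => wtW_nonneg D hp0 hp1 (x i)

/-- **Switching-certificate principle (three copies).**  Let `T b` (`b ∈ s`) be valid trees querying edges of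
`D`, `code` any function of a triple of configurations (e.g. the triple of terminal-connectivity types) and
`lam0`, `lam b` real potentials on codes.  If POINTWISE, for every input triple,
`lam0 (code x) + Σ_b lam b (code (swap3 (T b) x)) ≤ 0`, then
`Σ_x wt3W x · (lam0 (code x) + Σ_b lam b (code x)) ≤ 0` — i.e. the potentials' total expectation under
`μ ⊗ μ ⊗ μ` is nonpositive (each tree preserves the law, so `E[lam b (code ∘ swap3 (T b))] = E[lam b ∘ code]`).
This is the soundness half of the pattern LP of [GladkovZimin2024, §5] ("potentials … nonnegative on every
feasible pattern ⟹ … on every graph"), for three copies. [cite: GladkovZimin2024, §5 and Lemma 4.2] -/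
theorem certificate_sum_nonpos (D : Finset ι) {p : ι → ℝ} (hp0 : ∀ i, 0 ≤ p i) (hp1 : ∀ i, p i ≤ 1)
    {K : Type*} (code : (Fin 3 → Finset ι) → K) (lam0 : K → ℝ) {β : Type*} (s : Finset β)
    (T : β → DTree3 ι) (hV : ∀ b ∈ s, Valid3 (T b)) (hD : ∀ b ∈ s, support3 (T b) ⊆ D)
    (lam : β → K → ℝ)
    (hpt : ∀ x ∈ triples D, lam0 (code x) + ∑ b ∈ s, lam b (code (swap3 (T b) x)) ≤ 0) :
    ∑ x ∈ triples D, wt3W D p x * (lam0 (code x) + ∑ b ∈ s, lam b (code x)) ≤ 0 := by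
  have hswap : ∀ b ∈ s, ∑ x ∈ triples D, wt3W D p x * lam b (code (swap3 (T b) x)) =
      ∑ x ∈ triples D, wt3W D p x * lam b (code x) :=
    fun b hb => sum_wt3W_comp_swap3 p (T b) (hV b hb) D (hD b hb) (fun x => lam b (code x))
  have hrew : ∑ x ∈ triples D, wt3W D p x * (lam0 (code x) + ∑ b ∈ s, lam b (code x)) =
      ∑ x ∈ triples D, wt3W D p x * (lam0 (code x) + ∑ b ∈ s, lam b (code (swap3 (T b) x))) := by
    simp only [mul_add, sum_add_distrib, mul_sum]
    congr 1
    rw [sum_comm, sum_comm (s := triples D)]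
    exact sum_congr rfl fun b hb => (hswap b hb).symm
  rw [hrew]
  exact sum_nonpos fun x hx => mul_nonpos_of_nonneg_of_nonpos (wt3W_nonneg D hp0 hp1 x) (hpt x hx)

end Swap

end DTree3

/-! ### The counting form of the switching lemma, and two successive self-determined regions

[GladkovZimin2024, proof of Lemma 4.2]: "for every pair of configurations `C₃, C₄` there is only one path in
any decision tree leading to [them] and the probability of this path is equal to `ℙ(C₁)ℙ(C₂)`, which is equal
to `ℙ(C₃)ℙ(C₄)` since the probability in Bernoulli percolation is a product of probabilities for individual
edges."  Abstractly: a self-map of the triple space that, at every edge, PERMUTES the three bits, and is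
injective, preserves `μ ⊗ μ ⊗ μ`.  The trees used in [GladkovZimin2024, Examples 4.3–4.4 and the proof of
Thm. 4.6] ("query all edges connected to `c` and put them in `S`. Then query all not queried edges connected
to `a` … and put them in `S̄` …") explore successive clusters of ONE configuration and give each explored
edge region to a prescribed copy; in the language of [Gladkov2024, Def. 2.4] the first region `R(C₁)` is a
self-determined set and the second `S(C₁)` is disjoint from it and determined by `C₁` on `R(C₁) ∪ S(C₁)`
(the hypotheses `SelfDetermined R`, `hSR`, `hS` of `GladkovThreeClusterDichotomyProofs.Pr2W_resample`).  For
three copies the corresponding switching `splice3 R S` gives region `R(x₀)` of copy `0` to copy `1` and region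
`S(x₀)` to copy `2` (and vice versa); it is injective (explicit inverse `unsplice3`) and permutes bits
edgewise, hence preserves the triple law: `sum_wt3W_comp_splice3`. -/

section Counting

variable (p : ι → ℝ)

/-- A self-map of triples of configurations *permutes the copies edgewise* if at every coordinate the three
output bits are a permutation of the three input bits (the defining feature of every switching of
[GladkovZimin2024, Def. 4.1 / Lemma 4.2]). [cite: GladkovZimin2024, Def. 4.1 and Lemma 4.2] -/
def PermutesCopies (Φ : (Fin 3 → Finset ι) → (Fin 3 → Finset ι)) : Prop :=
  ∀ x i, ∃ π : Equiv.Perm (Fin 3), ∀ k, (i ∈ Φ x k ↔ i ∈ x (π k))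

/-- An edgewise copy-permuting map preserves the weight of every triple ("the probability in Bernoulli
percolation is a product of probabilities for individual edges"). [cite: GladkovZimin2024, proof of Lemma 4.2] -/
theorem wt3W_eq_of_permutesCopies {Φ : (Fin 3 → Finset ι) → (Fin 3 → Finset ι)}
    (hΦ : PermutesCopies Φ) (D : Finset ι) (x : Fin 3 → Finset ι) :
    wt3W D p (Φ x) = wt3W D p x := by
  unfold wt3W wtW
  rw [Finset.prod_comm, Finset.prod_comm (s := Finset.univ) (t := D)]
  refine prod_congr rfl fun i _ => ?_
  obtain ⟨π, hπ⟩ := hΦ x i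
  calc ∏ k, (if i ∈ Φ x k then p i else 1 - p i)
      = ∏ k, (if i ∈ x (π k) then p i else 1 - p i) := prod_congr rfl fun k _ => by simp only [hπ k]
    _ = ∏ k, (if i ∈ x k then p i else 1 - p i) :=
        Equiv.prod_comp π (fun k => if i ∈ x k then p i else 1 - p i)

/-- **Counting form of the switching lemma** [GladkovZimin2024, proof of Lemma 4.2]: an edgewise
copy-permuting self-map of the triples inside `D` that is injective is a weight-preserving bijection, so the
output triple has the law of the input triple: `Σ_x wt3W x · f (Φ x) = Σ_x wt3W x · f x`.
[cite: GladkovZimin2024, Lemma 4.2 (proof: one tree path per output pair, same product weight)] -/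
theorem sum_wt3W_comp_eq_of_injOn {Φ : (Fin 3 → Finset ι) → (Fin 3 → Finset ι)}
    (hΦ : PermutesCopies Φ) (D : Finset ι) (hmaps : ∀ x ∈ triples D, Φ x ∈ triples D)
    (hinj : Set.InjOn Φ (triples D)) (f : (Fin 3 → Finset ι) → ℝ) :
    ∑ x ∈ triples D, wt3W D p x * f (Φ x) = ∑ x ∈ triples D, wt3W D p x * f x := by
  have hmaps' : Set.MapsTo Φ (triples D) (triples D) := fun x hx => hmaps x hx
  have hsurj : Set.SurjOn Φ (triples D) (triples D) :=
    Finset.surjOn_of_injOn_of_card_le Φ hmaps' hinj le_rfl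
  calc ∑ x ∈ triples D, wt3W D p x * f (Φ x)
      = ∑ x ∈ triples D, wt3W D p (Φ x) * f (Φ x) :=
        sum_congr rfl fun x _ => by rw [wt3W_eq_of_permutesCopies p hΦ]
    _ = ∑ y ∈ triples D, wt3W D p y * f y :=
        Finset.sum_nbij Φ hmaps hinj hsurj fun x _ => rfl

end Counting

/-! ### Two successive regions of copy `0`: region `R` goes to copy `1`, region `S` to copy `2` -/

section Splice3

variable (R S : Finset ι → Finset ι)

/-- The three-copy switching of two successive explored regions of copy `0` [GladkovZimin2024, proof of
Thm. 4.6 (successive cluster explorations), three-copy form]: on `R(x₀)` copies `0` and `1` are exchanged, on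
`S(x₀)` copies `0` and `2` are exchanged, elsewhere nothing happens.  Output `0 = (x₁ on R, x₂ on S, x₀ else)`,
output `1 = (x₀ on R, x₁ else)`, output `2 = (x₀ on S, x₂ else)`.
[cite: GladkovZimin2024, Def. 4.1, Lemma 4.2 and proof of Thm. 4.6] -/
def splice3 (x : Fin 3 → Finset ι) : Fin 3 → Finset ι := fun k =>
  if k = 0 then splice (R (x 0)) (x 1) (splice (S (x 0)) (x 2) (x 0))
  else if k = 1 then splice (R (x 0)) (x 0) (x 1)
  else splice (S (x 0)) (x 0) (x 2)

/-- The inverse of `splice3`: the regions are read off the outputs (`R` from output `1`, which agrees with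
`x₀` on `R(x₀)`; then `S` from `(output 1 on R, output 2 else)`, which agrees with `x₀` on `R(x₀) ∪ S(x₀)`).
[cite: GladkovZimin2024, proof of Lemma 4.2 (uniqueness of the tree path)] -/
def unsplice3 (y : Fin 3 → Finset ι) : Fin 3 → Finset ι := fun k =>
  if k = 0 then splice (R (y 1)) (y 1) (splice (S (splice (R (y 1)) (y 1) (y 2))) (y 2) (y 0))
  else if k = 1 then splice (R (y 1)) (y 0) (y 1)
  else splice (S (splice (R (y 1)) (y 1) (y 2))) (y 0) (y 2)

variable {R S}

/-- Output `0` of `splice3`. [cite: GladkovZimin2024, Def. 4.1] -/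
@[simp] theorem splice3_zero (x : Fin 3 → Finset ι) :
    splice3 R S x 0 = splice (R (x 0)) (x 1) (splice (S (x 0)) (x 2) (x 0)) := by simp [splice3]
/-- Output `1` of `splice3`. [cite: GladkovZimin2024, Def. 4.1] -/
@[simp] theorem splice3_one (x : Fin 3 → Finset ι) :
    splice3 R S x 1 = splice (R (x 0)) (x 0) (x 1) := by simp [splice3]
/-- Output `2` of `splice3`. [cite: GladkovZimin2024, Def. 4.1] -/
@[simp] theorem splice3_two (x : Fin 3 → Finset ι) :
    splice3 R S x 2 = splice (S (x 0)) (x 0) (x 2) := by simp [splice3]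
/-- Component `0` of `unsplice3`. [cite: GladkovZimin2024, proof of Lemma 4.2] -/
@[simp] theorem unsplice3_zero (y : Fin 3 → Finset ι) : unsplice3 R S y 0 =
    splice (R (y 1)) (y 1) (splice (S (splice (R (y 1)) (y 1) (y 2))) (y 2) (y 0)) := by simp [unsplice3]
/-- Component `1` of `unsplice3`. [cite: GladkovZimin2024, proof of Lemma 4.2] -/
@[simp] theorem unsplice3_one (y : Fin 3 → Finset ι) :
    unsplice3 R S y 1 = splice (R (y 1)) (y 0) (y 1) := by simp [unsplice3]
/-- Component `2` of `unsplice3`. [cite: GladkovZimin2024, proof of Lemma 4.2] -/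
@[simp] theorem unsplice3_two (y : Fin 3 → Finset ι) :
    unsplice3 R S y 2 = splice (S (splice (R (y 1)) (y 1) (y 2))) (y 0) (y 2) := by simp [unsplice3]

/-- `splice3` permutes the copies edgewise (transposition `(0 1)` on `R`, `(0 2)` on `S`, identity elsewhere).
[cite: GladkovZimin2024, Def. 4.1] -/
theorem permutesCopies_splice3 (hSR : ∀ K, Disjoint (S K) (R K)) : PermutesCopies (splice3 R S) := by
  intro x i
  by_cases hiR : i ∈ R (x 0)
  · have hiS : i ∉ S (x 0) := fun h => Finset.disjoint_left.1 (hSR (x 0)) h hiR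
    refine ⟨Equiv.swap 0 1, fun k => ?_⟩
    fin_cases k <;>
      simp [mem_splice, hiR, hiS, Equiv.swap_apply_left, Equiv.swap_apply_right,
        Equiv.swap_apply_of_ne_of_ne]
  · by_cases hiS : i ∈ S (x 0)
    · refine ⟨Equiv.swap 0 2, fun k => ?_⟩
      fin_cases k <;>
        simp [mem_splice, hiR, hiS, Equiv.swap_apply_left, Equiv.swap_apply_right,
          Equiv.swap_apply_of_ne_of_ne]
    · refine ⟨Equiv.refl _, fun k => ?_⟩
      fin_cases k <;> simp [mem_splice, hiR, hiS]

omit [DecidableEq ι] in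
/-- Splicing configurations inside `D` stays inside `D`. [folklore] -/
private theorem splice_subset_of_subset [DecidableEq ι] {F A B D : Finset ι} (hA : A ⊆ D) (hB : B ⊆ D) :
    splice F A B ⊆ D := by
  intro i hi
  rcases mem_splice.1 hi with ⟨-, h⟩ | ⟨-, h⟩
  · exact hA h
  · exact hB h

/-- `splice3` maps triples of configurations inside `D` to triples inside `D` (the switched configurations
`C₁ →_S C₂` are configurations of the same edge set). [cite: GladkovZimin2024, Def. 4.1] -/
theorem splice3_mem_triples {D : Finset ι} {x : Fin 3 → Finset ι} (hx : x ∈ triples D) :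
    splice3 R S x ∈ triples D := by
  have h := mem_triples.1 hx
  refine mem_triples.2 fun k => ?_
  fin_cases k
  · exact splice_subset_of_subset (h 1) (splice_subset_of_subset (h 2) (h 0))
  · exact splice_subset_of_subset (h 0) (h 1)
  · exact splice_subset_of_subset (h 0) (h 2)

/-- With `R` self-determined and `S` disjoint from `R` and determined on `R ∪ S`, the regions are recovered
from the outputs: `R (splice3 x 1) = R (x 0)`. [cite: Gladkov2024, Def. 2.4 and Lemma 3.1] -/
theorem apply_splice3_one (hR : SelfDetermined R) (x : Fin 3 → Finset ι) :
    R (splice3 R S x 1) = R (x 0) :=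
  hR (x 0) _ fun _ hi => (mem_splice_of_mem hi).symm

/-- … and `S` is recovered from `(output 1 on R, output 2 elsewhere)`, which agrees with `x₀` on `R ∪ S`.
[cite: Gladkov2024, Def. 2.4 and Lemma 3.1] -/
theorem apply_splice3_aux (hR : SelfDetermined R) (hSR : ∀ K, Disjoint (S K) (R K))
    (hS : ∀ K K', (∀ i ∈ R K ∪ S K, (i ∈ K ↔ i ∈ K')) → S K' = S K) (x : Fin 3 → Finset ι) :
    S (splice (R (splice3 R S x 1)) (splice3 R S x 1) (splice3 R S x 2)) = S (x 0) := by
  rw [apply_splice3_one hR]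
  refine hS (x 0) _ fun i hi => ?_
  rcases Finset.mem_union.1 hi with hiR | hiS
  · simp [mem_splice, hiR]
  · have hiR : i ∉ R (x 0) := fun h => Finset.disjoint_left.1 (hSR (x 0)) hiS h
    simp [mem_splice, hiR, hiS]

/-- `unsplice3` is a left inverse of `splice3`. [cite: GladkovZimin2024, proof of Lemma 4.2] -/
theorem unsplice3_splice3 (hR : SelfDetermined R) (hSR : ∀ K, Disjoint (S K) (R K))
    (hS : ∀ K K', (∀ i ∈ R K ∪ S K, (i ∈ K ↔ i ∈ K')) → S K' = S K) (x : Fin 3 → Finset ι) :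
    unsplice3 R S (splice3 R S x) = x := by
  have h1 : R (splice3 R S x 1) = R (x 0) := apply_splice3_one hR x
  have h2 := apply_splice3_aux hR hSR hS x
  funext k
  fin_cases k
  · rw [show ((⟨0, by norm_num⟩ : Fin 3)) = 0 from rfl, unsplice3_zero, h2, h1]
    ext i
    by_cases hiR : i ∈ R (x 0)
    · simp [mem_splice, hiR]
    · by_cases hiS : i ∈ S (x 0)
      · simp [mem_splice, hiR, hiS]
      · simp [mem_splice, hiR, hiS]
  · rw [show ((⟨1, by norm_num⟩ : Fin 3)) = 1 from rfl, unsplice3_one, h1]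
    ext i
    by_cases hiR : i ∈ R (x 0)
    · simp [mem_splice, hiR]
    · simp [mem_splice, hiR]
  · rw [show ((⟨2, by norm_num⟩ : Fin 3)) = 2 from rfl, unsplice3_two, h2]
    ext i
    by_cases hiS : i ∈ S (x 0)
    · have hiR : i ∉ R (x 0) := fun h => Finset.disjoint_left.1 (hSR (x 0)) hiS h
      simp [mem_splice, hiR, hiS]
    · simp [mem_splice, hiS]

/-- `splice3` is injective. [cite: GladkovZimin2024, proof of Lemma 4.2] -/
theorem splice3_injective (hR : SelfDetermined R) (hSR : ∀ K, Disjoint (S K) (R K))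
    (hS : ∀ K K', (∀ i ∈ R K ∪ S K, (i ∈ K ↔ i ∈ K')) → S K' = S K) :
    Function.Injective (splice3 R S) :=
  Function.LeftInverse.injective (unsplice3_splice3 hR hSR hS)

variable (p : ι → ℝ)

/-- **Three-copy switching of two successive self-determined regions preserves `μ ⊗ μ ⊗ μ`**: for `R`
self-determined, `S` disjoint from `R` and determined on `R ∪ S`, and every `f`,
`Σ_x wt3W x · f (splice3 R S x) = Σ_x wt3W x · f x`.  With `S = ∅` this is the hybrid pair of
[GladkovZimin2024, Example 4.4] (third copy idle). [cite: GladkovZimin2024, Lemma 4.2, Examples 4.3–4.4 and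
proof of Thm. 4.6; Gladkov2024, Lemma 3.1] -/
theorem sum_wt3W_comp_splice3 (hR : SelfDetermined R) (hSR : ∀ K, Disjoint (S K) (R K))
    (hS : ∀ K K', (∀ i ∈ R K ∪ S K, (i ∈ K ↔ i ∈ K')) → S K' = S K) (D : Finset ι)
    (f : (Fin 3 → Finset ι) → ℝ) :
    ∑ x ∈ triples D, wt3W D p x * f (splice3 R S x) = ∑ x ∈ triples D, wt3W D p x * f x :=
  sum_wt3W_comp_eq_of_injOn p (permutesCopies_splice3 hSR) D (fun _ hx => splice3_mem_triples hx)
    (fun _ _ _ _ h => splice3_injective hR hSR hS h) f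

/-- Pushforward form: `Pr3W {x | splice3 R S x ∈ Y} = Pr3W Y`. [cite: GladkovZimin2024, Lemma 4.2] -/
theorem Pr3W_preimage_splice3 (hR : SelfDetermined R) (hSR : ∀ K, Disjoint (S K) (R K))
    (hS : ∀ K K', (∀ i ∈ R K ∪ S K, (i ∈ K ↔ i ∈ K')) → S K' = S K) (D : Finset ι)
    (Y : Set (Fin 3 → Finset ι)) :
    Pr3W D p {x | splice3 R S x ∈ Y} = Pr3W D p Y := by
  rw [Pr3W_eq_sum_ind, Pr3W_eq_sum_ind]
  have h := sum_wt3W_comp_splice3 p hR hSR hS D (ind Y)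
  refine Eq.trans (sum_congr rfl fun x _ => ?_) h
  by_cases hx : splice3 R S x ∈ Y
  · rw [ind_of_mem hx, ind_of_mem (show x ∈ {x | splice3 R S x ∈ Y} from hx)]
  · rw [ind_of_not_mem hx, ind_of_not_mem (show x ∉ {x | splice3 R S x ∈ Y} from hx)]

/-- "The three outputs are independent, each with law `μ`" for the two-region switching.
[cite: GladkovZimin2024, Lemma 4.2] -/
theorem Pr3W_splice3_mem_pi (hR : SelfDetermined R) (hSR : ∀ K, Disjoint (S K) (R K))
    (hS : ∀ K K', (∀ i ∈ R K ∪ S K, (i ∈ K ↔ i ∈ K')) → S K' = S K) (D : Finset ι)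
    (X : Fin 3 → Set (Finset ι)) :
    Pr3W D p {x | ∀ i, splice3 R S x i ∈ X i} = ∏ i, PrW D p (X i) := by
  rw [← DTree3.Pr3W_pi]
  exact Pr3W_preimage_splice3 p hR hSR hS D {x | ∀ i, x i ∈ X i}

end Splice3

end DecisionTree

end Literature.Probability.Percolation

end
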